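import Mathlib
import HarnessLib
import Summits.HubbardSuperconductivity.HubbardSuperconductivity.Theorems.KLProgrammeKLRegimeSplitFermiPointLevelC4
import Summits.HubbardSuperconductivity.HubbardSuperconductivity.Theorems.KLProgrammeImplicitRadiusDerivBounds

/-!
# Route `KLProgramme` — ENGINE child `KLRegimeEngineV11` (stmt-HubbardSuperconductivity-19823), two-leg stubs: QUANTITATIVE `C⁴`
# BOUNDS OF THE FRAME'S FERMI-POINT MAP `θ ↦ k_F^K(θ)` (BGM 2006 Lemma 2.1 to ORDER FOUR), part B — the radius and the curve
# (cell gate-hubbard-kl, seat p1b g5)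

The second input of `twoLegAngularG_of_curve_bounds` (`…SplitTwoLegReductions`): for a frame `K` with `‖Dʲ(frameShift K)‖ ≤ A` (`j ≤ 2`,
`2A < Dt_min`, `[μ − A, μ + A]` in the level range of `B : BandBounds a b` — p4's hypotheses) and `‖Dʲ(frameShift K)‖ ≤ A'` (`j ≤ 4`), the
Fermi-point map `γ(θ) = toLp 2 (klFermiPoint μ K θ)` has `‖Dⁱγ(θ)‖ ≤ Dⁱ`, `1 ≤ i ≤ 4`, with `D` explicit in `(A', Dt_min − 2A)`.
Part A (`…SplitFermiPointLevelC4`) bounds the level function `G(θ,t) = ε₀(t·dir θ) − K(t·dir θ)` and its partials.  Here: §3 the bootstrap of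
`…ImplicitRadiusDerivBounds` applied to `u_K = perturbedFermiRadius δ_K μ` (`u_K ∈ C⁴`, `u_K′ = −∂_θG/∂_tG` = p4's `deriv_of_isRoot`,
`∂_tG ≥ Dt_min − 2A` = p4's `Dtmin_sub_le_pertDt`, `|u_K| ≤ π√2 ≤ 5`): **`|u_K^{(j)}| ≤ D_u^j`**, `1 ≤ j ≤ 4`,
`D_u = 31104·(24(4+16A')9⁴)⁴/min(Dt_min − 2A, 1)⁴` (`abs_iteratedDeriv_frameRadius_le`); §4 `γ = toLp ∘ (u_K·dir)` by Leibniz: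
**`‖Dⁱγ‖ ≤ (20·D_u)ⁱ`**, `1 ≤ i ≤ 4` (`norm_iteratedDeriv_fermiPointLp_le`), and `γ ∈ C⁴` (`contDiff_four_fermiPointLp`) — exactly the
hypotheses `hγ`, `hD` of `twoLegAngularG_of_curve_bounds`.  Proofs only.
-/

noncomputable section

namespace Summit.HubbardSuperconductivity.HubbardSuperconductivity.Theorems.PerturbedFermiCurve

set_option linter.dupNamespace false -- summit = problem name (single-conjunct summit), D-0017

open Real Set Finset
open Literature.MathematicalPhysics.QuantumLattice Literature.MathematicalPhysics.QuantumLattice.BandSectorCounting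
open Summit.HubbardSuperconductivity.HubbardSuperconductivity.Theorems.DispersionFlow
open Summit.HubbardSuperconductivity.HubbardSuperconductivity.Theorems.KLRegimeSplit

/-! ## §3 The bootstrap applied to the frame's Fermi radius -/

section Radius

variable {a b : ℝ} (B : BandBounds a b) {K : TrigPolyC4v} {A A' : ℝ}
  (hA : ∀ p : Momentum, ∀ j ≤ 2, ‖iteratedFDeriv ℝ j (frameShift K) p‖ ≤ A) (hADt : 2 * A < B.Dtmin)
  (hA' : ∀ p : Momentum, ∀ j ≤ 4, ‖iteratedFDeriv ℝ j (frameShift K) p‖ ≤ A') (hA'1 : 1 ≤ A')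
  {μ : ℝ} (hlo : a ≤ μ - A) (hhi : μ + A ≤ b)
include B hA hADt hA' hA'1 hlo hhi

/-- The level-function constant `B_G = 24·(4 + 16A')·9⁴` and the transversality floor `d = min (Dt_min − 2A) 1` of the bootstrap. -/
theorem radius_bootstrap_data :
    let u := perturbedFermiRadius (fun k : Fin 2 → ℝ => -K.eval k) μ
    let G := fun p : ℝ × ℝ => rayDispersion p + (fun k : Fin 2 → ℝ => -K.eval k) (p.2 • dir p.1)
    ContDiff ℝ 4 u ∧
    (∀ θ, ∀ i ≤ 3, ‖iteratedFDeriv ℝ i (fun p : ℝ × ℝ => fderiv ℝ G p ((1 : ℝ), (0 : ℝ))) (θ, u θ)‖ ≤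
      24 * (4 + 16 * A') * 9 ^ 4) ∧
    (∀ θ, ∀ i ≤ 3, ‖iteratedFDeriv ℝ i (fun p : ℝ × ℝ => fderiv ℝ G p ((0 : ℝ), (1 : ℝ))) (θ, u θ)‖ ≤
      24 * (4 + 16 * A') * 9 ^ 4) ∧
    (∀ θ, min (B.Dtmin - 2 * A) 1 ≤ fderiv ℝ G (θ, u θ) ((0 : ℝ), (1 : ℝ))) ∧
    (∀ θ, deriv u θ = -(fderiv ℝ G (θ, u θ) ((1 : ℝ), (0 : ℝ))) / fderiv ℝ G (θ, u θ) ((0 : ℝ), (1 : ℝ))) := by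
  intro u G
  have hC : ContDiff ℝ ((⊤ : ℕ∞) : WithTop ℕ∞) (fun p : Fin 2 → ℝ => -K.eval p) := by
    rw [← frameShift_toLp_eq_neg_eval]; exact contDiff_frameShift_toLp K
  have hδ : ∀ k : Fin 2 → ℝ, (∀ i, |k i| ≤ π) → |(fun p : Fin 2 → ℝ => -K.eval p) k| ≤ A := fun k _ => by
    simpa [frameShift_toLp] using abs_frameShift_toLp_le hA k
  have hκ : ∀ k : Fin 2 → ℝ, (∀ i, |k i| ≤ π) → ‖fderiv ℝ (fun p : Fin 2 → ℝ => -K.eval p) k‖ ≤ 2 * A := fun k _ => by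
    rw [← frameShift_toLp_eq_neg_eval]; exact norm_fderiv_frameShift_toLp_le hA k
  have hroot := isBandFermiRadius_klFermiRadius B hA hlo hhi (μ := μ)
  have hu4 : ContDiff ℝ 4 u := contDiff_klFermiRadius B hA hADt hlo hhi (m := 4)
  -- the radius is at most `5`
  have hu5 : ∀ θ, |u θ| ≤ 5 := by
    intro θ
    have hpos : 0 < u θ := frameRadius_pos B hA hlo hhi θ
    have hle : u θ ≤ π * Real.sqrt 2 := frameRadius_le B hA hlo hhi θ
    rw [abs_of_pos hpos]
    have hs : Real.sqrt 2 ≤ 3 / 2 := by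
      rw [show (3 / 2 : ℝ) = Real.sqrt ((3 / 2) ^ 2) by rw [Real.sqrt_sq (by norm_num)]]
      exact Real.sqrt_le_sqrt (by norm_num)
    have hπ := Real.pi_lt_d2
    nlinarith [Real.pi_pos, Real.sqrt_nonneg 2]
  -- derivative bounds of `G` at the graph, orders `1 … 4`
  have hGb : ∀ θ, ∀ j, 1 ≤ j → j ≤ 4 → ‖iteratedFDeriv ℝ j G (θ, u θ)‖ ≤ 24 * (4 + 16 * A') * 9 ^ 4 := by
    intro θ j hj1 hj4
    refine (norm_iteratedFDeriv_pertLevel_le hA' hj4 (θ, u θ) (hu5 θ)).trans ?_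
    have hA0 : 0 ≤ 4 + 16 * A' := by linarith
    have hfac : (j.factorial : ℝ) ≤ 24 := by exact_mod_cast (Nat.factorial_le hj4)
    have hpow : (9 : ℝ) ^ j ≤ 9 ^ 4 := pow_le_pow_right₀ (by norm_num) hj4
    have := mul_le_mul hfac hpow (by positivity) (by norm_num)
    nlinarith
  refine ⟨hu4, fun θ i hi => ?_, fun θ i hi => ?_, fun θ => ?_, fun θ => ?_⟩
  · refine (norm_iteratedFDeriv_pertLevel_partial_le K _ hi _).trans ?_
    rw [show ‖((1 : ℝ), (0 : ℝ))‖ = 1 by simp [Prod.norm_def], one_mul]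
    exact hGb θ (i + 1) (by omega) (by omega)
  · refine (norm_iteratedFDeriv_pertLevel_partial_le K _ hi _).trans ?_
    rw [show ‖((0 : ℝ), (1 : ℝ))‖ = 1 by simp [Prod.norm_def], one_mul]
    exact hGb θ (i + 1) (by omega) (by omega)
  · rw [← pertLevel_radius_eq_fderiv K (θ, u θ)]
    exact (min_le_left _ _).trans (Dtmin_sub_le_pertDt B hδ hlo hhi hκ hroot θ)
  · rw [← pertLevel_radius_eq_fderiv K (θ, u θ), ← pertLevel_angle_eq_fderiv K (θ, u θ)]
    exact deriv_of_isRoot B hC (by simp) hδ hlo hhi hκ hADt hroot θ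

end Radius

/-! ## §4 The radius to order four, and the Fermi-point map `γ = toLp ∘ (u_K·dir)` -/

section Curve

variable {a b : ℝ} (B : BandBounds a b) {K : TrigPolyC4v} {A A' : ℝ}
  (hA : ∀ p : Momentum, ∀ j ≤ 2, ‖iteratedFDeriv ℝ j (frameShift K) p‖ ≤ A) (hADt : 2 * A < B.Dtmin)
  (hA' : ∀ p : Momentum, ∀ j ≤ 4, ‖iteratedFDeriv ℝ j (frameShift K) p‖ ≤ A') (hA'1 : 1 ≤ A')
  {μ : ℝ} (hlo : a ≤ μ - A) (hhi : μ + A ≤ b)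
include B hA hADt hA' hA'1 hlo hhi

/-- **BGM Lemma 2.1 TO ORDER FOUR — the radius**: with `B_G = 24·(4 + 16A')·9⁴`, `d = min (Dt_min − 2A) 1` and `D_u = 31104·B_G⁴/d⁴`,
`|u_K^{(j)}(θ)| ≤ D_u^j` for `1 ≤ j ≤ 4`. -/
theorem abs_iteratedDeriv_frameRadius_le (j : ℕ) (hj1 : 1 ≤ j) (hj4 : j ≤ 4) (θ : ℝ) :
    |iteratedDeriv j (perturbedFermiRadius (fun k : Fin 2 → ℝ => -K.eval k) μ) θ| ≤
      (31104 * (24 * (4 + 16 * A') * 9 ^ 4) ^ 4 / (min (B.Dtmin - 2 * A) 1) ^ 4) ^ j := by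
  obtain ⟨hu4, hbθ, hbt, hdt, hderiv⟩ := radius_bootstrap_data B hA hADt hA' hA'1 hlo hhi
  have hB1 : (1 : ℝ) ≤ 24 * (4 + 16 * A') * 9 ^ 4 := by nlinarith
  have hd : 0 < min (B.Dtmin - 2 * A) 1 := lt_min (by linarith) one_pos
  have hd1 : min (B.Dtmin - 2 * A) 1 ≤ 1 := min_le_right _ _
  exact abs_iteratedDeriv_le_pow_of_implicit hu4 (contDiff_pertLevel_partial K _) (contDiff_pertLevel_partial K _) hB1 hbθ hbt
    hd hd1 hdt hderiv j hj1 hj4 θ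

omit hA' hA'1 in
/-- The Fermi-point map in `Momentum` is `toLp ∘ (u_K·dir)` and is `C⁴`. -/
theorem contDiff_four_fermiPointLp : ContDiff ℝ 4 fun θ : ℝ => (WithLp.toLp 2 (klFermiPoint μ K θ) : Momentum) := by
  have h := contDiff_klFermiPoint B hA hADt hlo hhi (μ := μ) (m := 4)
  exact ((EuclideanSpace.equiv (Fin 2) ℝ).symm : (Fin 2 → ℝ) →L[ℝ] Momentum).contDiff.comp (by exact_mod_cast h)

/-- **BGM Lemma 2.1 TO ORDER FOUR — the Fermi-point map**: `‖Dⁱ(θ ↦ toLp 2 (k_F^K θ))‖ ≤ (20·D_u)ⁱ` for `1 ≤ i ≤ 4`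
(`D_u` as in `abs_iteratedDeriv_frameRadius_le`). -/
theorem norm_iteratedDeriv_fermiPointLp_le (i : ℕ) (hi1 : 1 ≤ i) (hi4 : i ≤ 4) (θ : ℝ) :
    ‖iteratedDeriv i (fun θ : ℝ => (WithLp.toLp 2 (klFermiPoint μ K θ) : Momentum)) θ‖ ≤
      (20 * (31104 * (24 * (4 + 16 * A') * 9 ^ 4) ^ 4 / (min (B.Dtmin - 2 * A) 1) ^ 4)) ^ i := by
  set Du : ℝ := 31104 * (24 * (4 + 16 * A') * 9 ^ 4) ^ 4 / (min (B.Dtmin - 2 * A) 1) ^ 4 with hDu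
  set u := perturbedFermiRadius (fun k : Fin 2 → ℝ => -K.eval k) μ with hudef
  have hd : 0 < min (B.Dtmin - 2 * A) 1 := lt_min (by linarith) one_pos
  have hd1 : min (B.Dtmin - 2 * A) 1 ≤ 1 := min_le_right _ _
  have hB1 : (1 : ℝ) ≤ 24 * (4 + 16 * A') * 9 ^ 4 := by nlinarith
  have hDu5 : 5 ≤ Du := by
    rw [hDu, le_div_iff₀ (by positivity)]
    have h1 : (min (B.Dtmin - 2 * A) 1) ^ 4 ≤ 1 := pow_le_one₀ hd.le hd1
    nlinarith [one_le_pow₀ (n := 4) hB1]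
  have hDu0 : 0 ≤ Du := by linarith
  -- `γ = T ∘ f`, `f = u • dir`
  set T := ((EuclideanSpace.equiv (Fin 2) ℝ).symm : (Fin 2 → ℝ) →L[ℝ] Momentum) with hT
  have hγ : (fun θ : ℝ => (WithLp.toLp 2 (klFermiPoint μ K θ) : Momentum)) = T ∘ fun θ => u θ • dir θ := by
    funext θ; simp [hT, klFermiPoint, hudef]
  have hu4 : ContDiff ℝ 4 u := contDiff_klFermiRadius B hA hADt hlo hhi (m := 4)
  have hf4 : ContDiff ℝ 4 (fun θ => u θ • dir θ) := hu4.smul contDiff_dir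
  rw [← norm_iteratedFDeriv_eq_norm_iteratedDeriv, hγ, T.iteratedFDeriv_comp_left hf4.contDiffAt (by exact_mod_cast hi4)]
  refine (T.norm_compContinuousMultilinearMap_le _).trans ?_
  -- Leibniz for `u • dir`
  have hL := norm_iteratedFDeriv_smul_le (N := ((4 : ℕ) : WithTop ℕ∞)) hu4 contDiff_dir θ (n := i) (by exact_mod_cast hi4)
  have hterm : ∀ k ∈ range (i + 1), (i.choose k : ℝ) * ‖iteratedFDeriv ℝ k u θ‖ * ‖iteratedFDeriv ℝ (i - k) dir θ‖ ≤
      (i.choose k : ℝ) * (5 * Du ^ k) := by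
    intro k hk
    have hki : k ≤ i := Nat.lt_succ_iff.1 (mem_range.1 hk)
    have hu_k : ‖iteratedFDeriv ℝ k u θ‖ ≤ 5 * Du ^ k := by
      rw [norm_iteratedFDeriv_eq_norm_iteratedDeriv, Real.norm_eq_abs]
      rcases Nat.eq_zero_or_pos k with rfl | hk1
      · rw [iteratedDeriv_zero, pow_zero, mul_one, hudef, abs_of_pos (frameRadius_pos B hA hlo hhi θ)]
        have hle := frameRadius_le B hA hlo hhi (μ := μ) θ
        have hs : Real.sqrt 2 ≤ 3 / 2 := by
          rw [show (3 / 2 : ℝ) = Real.sqrt ((3 / 2) ^ 2) by rw [Real.sqrt_sq (by norm_num)]]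
          exact Real.sqrt_le_sqrt (by norm_num)
        nlinarith [Real.pi_pos, Real.sqrt_nonneg 2, Real.pi_lt_d2]
      · have h := abs_iteratedDeriv_frameRadius_le B hA hADt hA' hA'1 hlo hhi k hk1 (hki.trans hi4) θ
        rw [← hDu] at h
        have : Du ^ k ≤ 5 * Du ^ k := by nlinarith [pow_nonneg hDu0 k]
        exact h.trans this
    calc (i.choose k : ℝ) * ‖iteratedFDeriv ℝ k u θ‖ * ‖iteratedFDeriv ℝ (i - k) dir θ‖
        ≤ (i.choose k : ℝ) * (5 * Du ^ k) * 1 :=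
          mul_le_mul (mul_le_mul_of_nonneg_left hu_k (by positivity)) (norm_iteratedFDeriv_dir_le _ _) (norm_nonneg _)
            (by positivity)
      _ = (i.choose k : ℝ) * (5 * Du ^ k) := mul_one _
  have hsum : ∑ k ∈ range (i + 1), (i.choose k : ℝ) * (5 * Du ^ k) = 5 * (Du + 1) ^ i := by
    rw [add_pow, mul_sum]
    refine sum_congr rfl fun k _ => ?_
    rw [one_pow, mul_one]; ring
  have hT2 : ‖T‖ ≤ 2 := norm_toLpCLM_le
  calc ‖T‖ * ‖iteratedFDeriv ℝ i (fun θ => u θ • dir θ) θ‖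
      ≤ 2 * (5 * (Du + 1) ^ i) := by
        refine mul_le_mul hT2 (hL.trans ((sum_le_sum hterm).trans hsum.le)) (norm_nonneg _) (by norm_num)
    _ ≤ (20 * Du) ^ i := by
        -- `10·(D+1)^i ≤ 10·(2D)^i ≤ (20D)^i` for `i ≥ 1`, `D ≥ 5`
        have h1 : (Du + 1) ^ i ≤ (2 * Du) ^ i := pow_le_pow_left₀ (by linarith) (by linarith) i
        obtain ⟨m, rfl⟩ : ∃ m, i = m + 1 := ⟨i - 1, by omega⟩
        have hX : 0 ≤ (2 * Du) ^ (m + 1) := pow_nonneg (by linarith) _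
        have h10 : (10 : ℝ) ≤ 10 ^ (m + 1) := le_self_pow₀ (by norm_num) (by omega)
        have h2 : (10 : ℝ) * (2 * Du) ^ (m + 1) ≤ (20 * Du) ^ (m + 1) := by
          calc (10 : ℝ) * (2 * Du) ^ (m + 1) ≤ 10 ^ (m + 1) * (2 * Du) ^ (m + 1) := mul_le_mul_of_nonneg_right h10 hX
            _ = (20 * Du) ^ (m + 1) := by rw [← mul_pow]; ring
        nlinarith

end Curve

end Summit.HubbardSuperconductivity.HubbardSuperconductivity.Theorems.PerturbedFermiCurve

end
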